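import Summits.BirchSwinnertonDyer.BirchSwinnertonDyer.Theorems.SchneiderFreeAdditiveX3UpperWingField
import Summits.BirchSwinnertonDyer.BirchSwinnertonDyer.Theorems.SchneiderFreeAdditiveX3BranchIMCRebaseArtinRoad
import Literature.NumberTheory.EllipticCurves.ModularParametrizationBCDTProofs
import HarnessLib

/-!
# Schneider-free additive X3 door, SECOND WING — the (G-ord, `e = 2`) co-socket record, the wing and the leaf
# candidate RESTRICTED TO CASTELLA–HSIEH'S PRINT SCOPE `p ∤ φ(N′)` (Hypothesis (H)(a)); leaf candidate v4 with the
# value input SPLIT into its (H)(a)-scope part and its off-scope part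

Cell `bsd-schneider-ideate` (HOME `run/shared/lean/pub/bsd-schneider-ideate/`), seat `bsd-schneider-door-c5` (prover,
generation 11). PARTITION: board row B6 ∩ X3 ∩ sst-twist, `r = 1`, (G-ord, `e = 2`) half (2 560 of 7 101 pairs) of
`Rank1Residual.partition`; SHRINKS-to-print-scope the second wing's (G-ord) value input; closes nothing; no rung leaf
registered; BSD is NOT advanced.

WHY. Castella–Hsieh (Math. Ann. 370 (2018)) state Hypothesis (H)(a) `p ∤ 2(2r−1)!·N·φ(N)` «throughout» and re-impose it
in §4.2 where the classes of Lemma 5.4 / Thm. 5.7 are defined (lit sheet `pub/bsd-stepL/audit/CH18-VALUE-N1-COFACTOR-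
lit-g17.md` FLAG F1; referee g34 §1(d): REQUIRED binder of any verbatim typing, wi-73260). The wing's value input
`KYRead.KYReadCHValueUnit` (this seat, gen 10) reads that formula for the good-ordinary partner `W′` of the door's
curve `W ≅ W′ ⊗ χ_{p*}` WITHOUT the binder `p ∤ φ(N_{W′})`. Gen 11 split it (`…UpperKYReadHypsBranch.lean`, appended):
`KYReadCHValueUnit ↔ KYReadCHValueUnitH ∧ KYReadCHValueUnitOffScope`. Here:

* §0 arithmetic: for a prime `p ∤ N′`, `p ∣ φ(n) ↔ ∃ prime ℓ ∣ n, p ∣ ℓ − 1` and `p² ∣ φ(N′p²) ↔ p ∣ φ(N′)`; so ON THE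
  DOOR'S CURVE (`N_W = N_{W′}·p²`, `conductorNorm_presentation_eq`) the binder reads `¬ p² ∣ φ(N_W)` — equivalently: no
  bad prime `ℓ ≠ p` of `W` with `ℓ ≡ 1 (mod p)` (`not_sq_dvd_totient_conductor_iff_forall_prime`). Conductor-only, hence
  carried for free to door-c4's good member `W₁` (`N_{W₁} = N_W`).
* §1 `additiveIMCUpperBDPInputManinAtField_of_facts_of_KY_branch_of_CHValueUnitH` — gen 10's FIELD-LOCAL (G-ord)
  co-socket record (p502451 §3) from the named facts + `hKYb` (PRE) + `hCHx` (PUB) + `hValUH : KYReadCHValueUnitH`,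
  concluding the co-socket at every KY-normalised `(W, p)` on the cell WITH `¬ p² ∣ φ(N_W)`.
* §2 the scoped co-chain member and the wing: `missingUpperBoundAt_gordTwo_scope_of_coIMCField_of_control_of_…` (the
  upper half `MissingUpperBoundAt W p` at every (G-ord, `e = 2`) door curve in scope) and the door form on
  (M) ∪ ((G-ord) ∩ scope).
* §3 from NAMED inputs: the wing on (M) ∪ ((G-ord) ∩ scope) with NO off-scope input
  (`missingUpperBoundAt_sstTwist_scope_of_KYReadBranchH_of_PotMultRead_of_twistUnitFieldOffSliver`), and the leaf
  candidate v4 = v3 with the value input SPLIT: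
  `additiveX3RankOneUpper_of_KYReadBranchH_of_offScope_of_PotMultRead_of_twistUnitFieldOffSliver :
  PrintedFacts → ControlFacts → (CM-rationality ∧ CST 1.1) → (Darmon 3.6 ∧ CST 1.5) → thm351_charIdeal_eq_branch_OPEN →
  castellaHsieh2018_… → KYReadCHValueUnitH → KYReadCHValueUnitOffScope → KYCHMUnitOriented → hTU′ → AdditiveX3RankOneUpper`.

CENSUS (gen 11, `memos/census-P2-g4/h0census.tsv.gz`, `N′ = N/p²`): scope holds on 557 / 2 560 (G-ord, `e = 2`) pairs
(482 / 2 411 at `p = 3`, 75 / 149 at `p ≥ 5`) = 21.8 %; off scope 2 003 = 78.2 %. HONEST FRAMING: CONDITIONAL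
theorems on displayed hypotheses (`hKYb` unrefereed preprint BY NAME, `hCHx` published BY NAME, `hValUH` published-in-
scope but untyped, `hValUOff` NOT in print); closes no item; BSD not advanced. Whether Castella–Hsieh §5 actually uses
the `φ(N)` part of (H)(a) is an open PRINT question — if not, `KYReadCHValueUnitOffScope` becomes typable too and v4
collapses back to v3 by `kyReadCHValueUnit_of_unitH_of_offScope`.

References: [CastellaHsieh2018] Hypothesis (H) p. 569, §4.2, Lemma 5.4, Thm. 5.7; [KellerYin2024b] Thm. 3.5.1,
Assumption 2.0.3; [Castella2020JIMJ] Thm. A (the φ(N)-free road; needs residual irreducibility); [AtkinLehner1970] §6;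
[JetchevSkinnerWan2017] §7.4.1; [Miller2011LMS] Def. 1.1; [GrossZagier1986] I.(6.3), (7.3); [Mazur1978] Prop. 5.4.
-/

noncomputable section

open scoped Classical

open WeierstrassCurve NumberField IsDedekindDomain Field Literature.NumberTheory.EllipticCurves
  Literature.NumberTheory.EllipticCurves.ModularForms Literature.NumberTheory.EllipticCurves.GreenbergSelmer
  Literature.NumberTheory.EllipticCurves.CaiShuTian2014
  Literature.NumberTheory.EllipticCurves.Rank1Residual Literature.NumberTheory.EllipticCurves.Rank1Residual.Typed
  Literature.NumberTheory.GaloisRepresentations Literature.NumberTheory.GaloisCohomology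
  Literature.NumberTheory.EllipticCurves.KellerYin2024
  Summit.BirchSwinnertonDyer.Rank1Residual Summit.BirchSwinnertonDyer.Rank1Residual.Additive
  Summit.BirchSwinnertonDyer.Rank1Residual.X11b Summit.BirchSwinnertonDyer.Rank1Residual.X11b.AcSelmer
  Summit.BirchSwinnertonDyer.Rank1Residual.X11b.Halves Summit.BirchSwinnertonDyer.BirchSwinnertonDyer.Theorems.SchneiderFree
  Summit.BirchSwinnertonDyer.BirchSwinnertonDyer.Theorems.SchneiderFree.KYRead
  Summit.BirchSwinnertonDyer.BirchSwinnertonDyer.Theorems.SchneiderFree.PotMultRead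
  Summit.BirchSwinnertonDyer.BirchSwinnertonDyer.Theses.SchneiderFreeAdditiveX3

set_option linter.dupNamespace false
set_option autoImplicit false

namespace Summit.BirchSwinnertonDyer.BirchSwinnertonDyer.Theorems.SchneiderFree.Upper

/-! ### §0 Arithmetic of the (H)(a) binder: `p ∣ φ(n)`, `p² ∣ φ(N′p²)`, and the binder on the door's curve -/

/-- For a prime `p` NOT dividing `n ≠ 0`: `p ∣ φ(n)` iff some prime `ℓ ∣ n` has `p ∣ ℓ − 1`
(`φ(n) = ∏_{ℓ^k ‖ n} ℓ^{k−1}(ℓ − 1)`; `p ∣ ℓ^{k−1}` would force `p = ℓ ∣ n`). [folklore] -/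
theorem prime_dvd_totient_iff_exists_prime_dvd_sub_one {p n : ℕ} (hp : p.Prime) (hn : n ≠ 0)
    (hpn : ¬ p ∣ n) : p ∣ Nat.totient n ↔ ∃ ℓ : ℕ, ℓ.Prime ∧ ℓ ∣ n ∧ p ∣ ℓ - 1 := by
  constructor
  · intro h
    rw [Nat.totient_eq_prod_factorization hn, Finsupp.prod, Nat.support_factorization] at h
    obtain ⟨ℓ, hℓ, hdvd⟩ := (hp.prime.dvd_finsetProd_iff _).mp h
    have hℓp : ℓ.Prime := Nat.prime_of_mem_primeFactors hℓ
    have hℓn : ℓ ∣ n := Nat.dvd_of_mem_primeFactors hℓ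
    refine ⟨ℓ, hℓp, hℓn, ?_⟩
    rcases (Nat.Prime.dvd_mul hp).mp hdvd with h1 | h1
    · have hpl : p = ℓ := (Nat.prime_dvd_prime_iff_eq hp hℓp).mp (hp.dvd_of_dvd_pow h1)
      exact absurd (hpl ▸ hℓn) hpn
    · exact h1
  · rintro ⟨ℓ, hℓ, hℓn, hpl⟩
    exact hpl.trans ((Nat.totient_prime hℓ) ▸ Nat.totient_dvd_of_dvd hℓn)

/-- A prime never divides its predecessor: `¬ p ∣ p − 1`. [folklore] -/
theorem prime_not_dvd_self_sub_one {p : ℕ} (hp : p.Prime) : ¬ p ∣ p - 1 :=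
  Nat.not_dvd_of_pos_of_lt (Nat.sub_pos_of_lt hp.one_lt) (Nat.sub_lt hp.pos Nat.one_pos)

/-- For a prime `p ∤ N′`: `p² ∣ φ(N′·p²) ↔ p ∣ φ(N′)` (`φ(N′p²) = φ(N′)·p·(p − 1)` and `p ∤ p − 1`). [folklore] -/
theorem sq_dvd_totient_mul_sq_iff {p N' : ℕ} (hp : p.Prime) (hpN' : ¬ p ∣ N') :
    p ^ 2 ∣ Nat.totient (N' * p ^ 2) ↔ p ∣ Nat.totient N' := by
  have hcop : Nat.Coprime N' (p ^ 2) :=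
    (Nat.Coprime.pow_right 2 (Nat.coprime_comm.mp (hp.coprime_iff_not_dvd.mpr hpN')))
  rw [Nat.totient_mul hcop, Nat.totient_prime_pow hp Nat.two_pos]
  simp only [Nat.add_one_sub_one, pow_one]
  constructor
  · intro h
    have h' : p * p ∣ Nat.totient N' * (p - 1) * p := by
      have : Nat.totient N' * (p * (p - 1)) = Nat.totient N' * (p - 1) * p := by ring
      rw [← this, ← sq]; exact h
    have h'' : p ∣ Nat.totient N' * (p - 1) := (Nat.mul_dvd_mul_iff_right hp.pos).mp h'
    exact ((Nat.Prime.dvd_mul hp).mp h'').resolve_right (prime_not_dvd_self_sub_one hp)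
  · intro h
    rw [sq]
    exact Nat.mul_dvd_mul h (dvd_mul_right p _)

/-- **The (H)(a) binder on the door's curve, prime form.** If `N_W = N′·p²` with `p ∤ N′`, `N′ ≠ 0`, then
`¬ p² ∣ φ(N_W)` iff every prime `ℓ ∣ N_W` with `ℓ ≠ p` has `p ∤ ℓ − 1` (no bad prime other than `p` is
`≡ 1 (mod p)`) — iff `p ∤ φ(N′)`, Castella–Hsieh's Hypothesis (H)(a) at weight 2 for the partner's level `N′`.
This is the predicate the gen-11 census evaluates (557 / 2 560 (G-ord, `e = 2`) pairs).
[cite: CastellaHsieh2018, Hypothesis (H)(a) p. 569] -/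
theorem not_sq_dvd_totient_conductor_iff_forall_prime {W : WeierstrassCurve ℚ} {p N' : ℕ} (hp : p.Prime)
    (hN : W.conductorNorm ℤ = N' * p ^ 2) (hpN' : ¬ p ∣ N') (hN'0 : N' ≠ 0) :
    ¬ p ^ 2 ∣ Nat.totient (W.conductorNorm ℤ) ↔
      ∀ ℓ : ℕ, ℓ.Prime → ℓ ∣ W.conductorNorm ℤ → ℓ ≠ p → ¬ p ∣ ℓ - 1 := by
  rw [hN, sq_dvd_totient_mul_sq_iff hp hpN', prime_dvd_totient_iff_exists_prime_dvd_sub_one hp hN'0 hpN']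
  constructor
  · intro h ℓ hℓ hℓN hℓp hpl
    refine h ⟨ℓ, hℓ, ?_, hpl⟩
    exact ((Nat.Prime.dvd_mul hℓ).mp hℓN).resolve_right
      (fun h2 ↦ hℓp ((Nat.prime_dvd_prime_iff_eq hℓ hp).mp (hℓ.dvd_of_dvd_pow h2)))
  · rintro h ⟨ℓ, hℓ, hℓN', hpl⟩
    refine h ℓ hℓ (hℓN'.mul_right _) ?_ hpl
    rintro rfl
    exact hpN' hℓN'

/-- **The binder on the door's curve gives Castella–Hsieh's binder for the partner.** For the door's presentation
`W = C₂ • ((D • W′) ⊗ χ_{p*})` with `W′` of good reduction at the odd prime `p` (so `N_W = N_{W′}·p²`,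
`conductorNorm_presentation_eq`, modularity paying for Atkin–Lehner): `¬ p² ∣ φ(N_W) → ¬ p ∣ φ(N_{W′})`.
[cite: CastellaHsieh2018, Hypothesis (H)(a) p. 569] [cite: AtkinLehner1970, §6] -/
theorem not_dvd_totient_partner_of_not_sq_dvd_totient (hPar : nonempty_modularParametrizationData) {p : ℕ}
    [Fact p.Prime] (hp2 : p ≠ 2) (W' : WeierstrassCurve ℚ) [W'.IsElliptic] (hgood : W'.HasGoodReductionAtPrime p)
    (D C₂ : VariableChange ℚ)
    (hsc : ¬ p ^ 2 ∣ Nat.totient ((C₂ • (D • W').quadraticTwist ((-1 : ℚ) ^ (p / 2) * p)).conductorNorm ℤ)) :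
    ¬ p ∣ Nat.totient (W'.conductorNorm ℤ) := by
  have hp : p.Prime := Fact.out
  have hpN' : ¬ p ∣ W'.conductorNorm ℤ := fun h ↦
    (W'.dvd_conductorNorm_iff_not_hasGoodReductionAtPrime p).mp h hgood
  rw [conductorNorm_presentation_eq (exists_isNewformOf_of_nonempty_modularParametrizationData hPar) hp2 W' hgood
    D C₂, sq_dvd_totient_mul_sq_iff hp hpN'] at hsc
  exact hsc

/-! ### §1 The (G-ord) field-local co-socket record ON THE (H)(a) SCOPE -/

/-- **The (G-ord, `e = 2`) FIELD-LOCAL co-socket record at fields with `d_K ≠ −3`, branch currency, Gross-free, no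
sliver stub — ON CASTELLA–HSIEH'S PRINT SCOPE.** VERBATIM this seat's gen-10
`additiveIMCUpperBDPInputManinAtField_of_facts_of_KY_branch_of_CHValueUnit` (p502451 §3) with the value input weakened
to `hValUH : KYReadCHValueUnitH` (the (H)(a) binder `¬ p ∣ φ(N_{W′})` carried) and, accordingly, ONE hypothesis
added on the door's curve: `¬ p² ∣ φ(N_W)` (= `p ∤ φ(N_{W′})` by §0). For every `(W, p)` with `p ≠ 2`, `ClassX3 W p`,
`SubGordTwo W p`, `¬ p² ∣ φ(N_W)`, KY-normalised, and every imaginary quadratic `K` with `d_K ≠ −3`: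
`AdditiveIMCUpperBDPInputManinAtField W p K`. CONDITIONAL on the displayed hypotheses; nothing asserted about BSD.
[cite: KellerYin2024b, Thm. 3.5.1, Rem. 3.5.2, Assumption 2.0.3 (preprint)]
[cite: CastellaHsieh2018, Hypothesis (H)(a), Prop. 3.8, Thm. 5.7 and Lemma 5.4] [cite: JetchevSkinnerWan2017, §7.4.1] -/
theorem additiveIMCUpperBDPInputManinAtField_of_facts_of_KY_branch_of_CHValueUnitH
    (hPT : ∀ (K : Type) [Field K] [NumberField K], poitouTate_selmerStructure_duality K)
    (hKo : ∀ (N : ℕ) [NeZero N] (W : WeierstrassCurve ℚ) (K : Type) [Field K] [NumberField K],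
      Literature.NumberTheory.EllipticCurves.kolyvagin N W K)
    (hGZ : ∀ (N : ℕ) [NeZero N] (W : WeierstrassCurve ℚ) (K : Type) [Field K] [NumberField K],
      Literature.NumberTheory.EllipticCurves.gross_zagier N W K)
    (hmod : hasEntireLFunction_rat) (hPar : nonempty_modularParametrizationData)
    (hRat : phi_heegnerPointOfConductor_mem_ringClassField) (hCST : thm11_ringClassChar)
    (hKYb : thm351_charIdeal_eq_branch_OPEN) (hCHx : castellaHsieh2018_exists_isBranchBDPLFunction)
    (hValUH : KYReadCHValueUnitH) :
    ∀ (W : WeierstrassCurve ℚ) [W.IsElliptic] [W.IsGloballyMinimal] (p : ℕ) [Fact p.Prime],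
      p ≠ 2 → ClassX3 W p → Additive.SubGordTwo W p → ¬ p ^ 2 ∣ Nat.totient (W.conductorNorm ℤ) →
      (∃ Φ : AddSubgroup (geomTorsion W (p : ℤ)), IsRationalLine W p Φ ∧ ¬ LineDecompositionTrivialAt W p Φ) →
      ∀ (K : Type) [Field K] [NumberField K], IsImaginaryQuadratic K → NumberField.discr K ≠ -3 →
        AdditiveIMCUpperBDPInputManinAtField W p K := by
  intro W _ _ p _ hp2 hX hS hsc hlat K _ _ hK hdK
  have hp : p.Prime := Fact.out
  have hcase : W.HasGoodOrdinaryReductionOverQuadraticAt p :=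
    hasGoodOrdinaryReductionOverQuadraticAt_of_subGordTwo hp2 W hX hS
  obtain ⟨Φ₀, hΦ₀, -⟩ := id hlat
  have hred : Red W p := red_of_isRationalLine hΦ₀
  obtain ⟨W', hE', hmin', C₂, hW, hord, hΔ⟩ :=
    exists_goodOrd_partner_presentation_of_subGordTwo_odd hp2 W hX hS
  subst hW
  haveI : NeZero (W'.conductorNorm ℤ) := ⟨(WeierstrassCurve.conductorNorm_pos_holds W').ne'⟩
  haveI : ((@WeierstrassCurve.toCharNeTwoNF ℚ _ W' (invertibleOfNonzero two_ne_zero)) • W').IsCharNeTwoNF :=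
    @WeierstrassCurve.toCharNeTwoNF_spec ℚ _ W' (invertibleOfNonzero two_ne_zero)
  -- the (H)(a) binder for the partner's level, from the binder on the door's curve (§0)
  have hφ : ¬ p ∣ Nat.totient (W'.conductorNorm ℤ) :=
    not_dvd_totient_partner_of_not_sq_dvd_totient hPar hp2 W' hord.1 _ C₂ hsc
  intro N _ Dt H ι P hr' hloc hN _ hodd hunit hHe hL hP hnt htf κ hκ γ _ 𝔭 h𝔭 he hf
  obtain ⟨n, hn⟩ :=
    Summit.BirchSwinnertonDyer.BirchSwinnertonDyer.Theorems.SchneiderFreeAdditiveX3.exists_hasCharValuationAt_of_pt_of_kolyvagin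
      hPT hKo _ p hr' hp2 hX (Or.inr hS) N K Dt H ι P hr' hloc hN hK hodd hunit hHe hL hP hnt κ hκ γ 𝔭 h𝔭
      he hf
  obtain ⟨Dt'⟩ := hPar W'
  haveI := (finiteDimensional_and_isGalois_ringClassField hK ι hp.ne_zero).1
  haveI : FiniteDimensional ℚ (ringClassField K ι p) := Module.Finite.trans K _
  haveI : NumberField (ringClassField K ι p) := NumberField.mk
  haveI : IsGalois ℚ K := Literature.FieldTheory.Galois.isGalois_of_finrank_eq_two hK.1
  have hV' : padicValInt p W'.minimalDiscriminantInt < 6 := by rw [hΔ]; norm_num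
  obtain ⟨𝔭', h𝔭', hne, he', hf'⟩ := exists_conjugate_degreeOne hK.1 h𝔭 he hf
  obtain ⟨ι₀⟩ := PadicAlgCl.nonempty_ringEquiv_complex p
  obtain ⟨ι', -, hι'⟩ := exists_datum_forall_mem_iff p ι₀ hK h𝔭'
  have hval := hValUH p W' _ C₂ N K Dt H ι P hr' hloc hN hK hodd hunit hHe hL hP hnt hp2 hord hφ hdK κ hκ γ 𝔭
    h𝔭 he hf Dt' 𝔭' h𝔭' he' hf' hne ι' hι'
  exact additiveIMCUpperBDPOnTreeLeAt_of_KY_branch_of_valueAtUnit_conj hmod hPar hRat hCST hKYb hCHx hp2 W'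
    hord.1 hV' _ C₂ hX.2 K hK hHe hodd hdK hunit hκ h𝔭 he hf h𝔭' he' hf' hne hι' (hGZ N _ K) (hKo N _ K) Dt H
    ι P hP hnt hn hN hcase hred hlat htf ι Dt' hval

/-! ### §2 The scoped co-chain member and the wing on (G-ord) ∩ scope; the door form -/

/-- **Co-chain member on the (G-ord, `e = 2`) cell AT A FIELD `K` with `d_K ≠ −3`, ON THE SCOPE** — VERBATIM gen 10's
`coChainMemberField_gordTwo_of_coIMCField_of_control` with the co-socket `hCo` asked only at curves with
`¬ p² ∣ φ(N)` and that binder assumed for `W`; it passes to door-c4's good member `W₁` because `N_{W₁} = N_W`.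
[cite: KellerYin2024b, §3.3 ¶1 and Assumption 2.0.3 (arXiv:2410.23241 pp. 8, 14)] [cite: Mazur1978, Prop. 5.4]
[cite: CastellaHsieh2018, Hypothesis (H)(a)] [cite: JetchevSkinnerWan2017, §7.4.1] -/
theorem coChainMemberField_gordTwo_scope_of_coIMCField_of_control
    (hKo : ∀ (N : ℕ) [NeZero N] (W : WeierstrassCurve ℚ) (K : Type) [Field K] [NumberField K],
      kolyvagin N W K)
    (hPar : nonempty_modularParametrizationData)
    (hCtl : ∀ (W : WeierstrassCurve ℚ) [W.IsElliptic] [W.IsGloballyMinimal] (p : ℕ) [Fact p.Prime],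
      W.analyticRank = 1 → p ≠ 2 → ClassX3 W p → Additive.SubSemistableTwist W p →
      AdditiveControlInputManinAt W p)
    (hCo : ∀ (W : WeierstrassCurve ℚ) [W.IsElliptic] [W.IsGloballyMinimal] (p : ℕ) [Fact p.Prime],
      p ≠ 2 → ClassX3 W p → Additive.SubGordTwo W p → ¬ p ^ 2 ∣ Nat.totient (W.conductorNorm ℤ) →
      (∃ Φ : AddSubgroup (geomTorsion W (p : ℤ)), IsRationalLine W p Φ ∧ ¬ LineDecompositionTrivialAt W p Φ) →
      ∀ (K : Type) [Field K] [NumberField K], IsImaginaryQuadratic K → NumberField.discr K ≠ -3 →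
        AdditiveIMCUpperBDPInputManinAtField W p K)
    (W : WeierstrassCurve ℚ) [W.IsElliptic] [W.IsGloballyMinimal] (p : ℕ) [Fact p.Prime]
    (hr : W.analyticRank = 1) (hp2 : p ≠ 2) (hX : ClassX3 W p) (hS : Additive.SubGordTwo W p)
    (hsc : ¬ p ^ 2 ∣ Nat.totient (W.conductorNorm ℤ))
    (K : Type) [Field K] [NumberField K] (hK : IsImaginaryQuadratic K)
    (hpd : ¬ (p : ℤ) ∣ NumberField.discr K) (hdK : NumberField.discr K ≠ -3) :
    ∃ (W₁ : WeierstrassCurve ℚ) (_ : W₁.IsElliptic) (_ : W₁.IsGloballyMinimal),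
      IsIsogenous W W₁ ∧ W₁.conductorNorm ℤ = W.conductorNorm ℤ ∧ Additive.N10.Locus W₁ p ∧
      (∀ Q : (W₁.baseChange K).toAffine.Point, p • Q = 0 → Q = 0) ∧ AdditiveCoStepLInputManinAtField W₁ p K := by
  have hp : p.Prime := Fact.out
  obtain ⟨W₁, hE₁, hmin₁, φ, m, -, -, hN₁, -, hred₁, hlat₁, htf₁⟩ :=
    GoodMember.exists_goodMember_of_modularParametrization hPar hp2 W hX hS K hK.1 hpd
  have hiso₁ : IsIsogenous W₁ W := ⟨φ⟩
  have hiso₁' : IsIsogenous W W₁ := hiso₁.symm_of_isElliptic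
  have hG : TypeG W p := (subGord_iff_typeG_of_addv W p hp2 hX.2).mp hS.1
  have hadd₁ : Addv W₁ p := Addv.of_isIsogenous_of_typeG hX.2 hG hiso₁'
  have hSG₁ : SubGord W₁ p := (subGord_iff_of_isIsogenous hp2 hX.2 hiso₁').mp hS.1
  have he₁ : semistabilityIndex W₁ p = 2 :=
    (semistabilityIndex_eq_of_isIsogenous_of_typeG_of_addv hp2 hX.2 hG hiso₁').trans hS.2
  have hX₁ : ClassX3 W₁ p := ⟨hred₁, hadd₁⟩
  have hS₁ : Additive.SubGordTwo W₁ p := ⟨hSG₁, he₁⟩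
  have hr₁ : W₁.analyticRank = 1 := by rw [analyticRank_eq_of_isIsogenous' hiso₁, hr]
  -- the binder is conductor-only: it holds for the good member too
  have hsc₁ : ¬ p ^ 2 ∣ Nat.totient (W₁.conductorNorm ℤ) := by rw [hN₁]; exact hsc
  have hloc₁ : Additive.N10.Locus W₁ p :=
    (Additive.N10.locus_iff_cells W₁ p).mpr
      ((Additive.N10.cellM_or_cellGordTwo_of_classX3_of_subSemistableTwist W₁ p hp2 hX₁ (Or.inr hS₁)).elim
        Or.inl (fun h ↦ Or.inr (Or.inl h)))
  have hco : AdditiveCoStepLInputManinAtField W₁ p K :=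
    additiveCoStepLInputManinAtField_of_kolyvagin_of_control_of_imcUpperField (fun N _ K _ _ ↦ hKo N W₁ K)
      (hCtl W₁ p hr₁ hp2 hX₁ (Or.inr hS₁)) (hCo W₁ p hp2 hX₁ hS₁ hsc₁ hlat₁ K hK hdK)
  exact ⟨W₁, hE₁, hmin₁, hiso₁', hN₁, hloc₁, htf₁, hco⟩

/-- **The second wing on the whole door with the (G-ord) co-socket asked ONLY ON THE (H)(a) SCOPE** — the door form:
for every door curve on (M) ∪ ((G-ord, `e = 2`) ∩ {`¬ p² ∣ φ(N_W)`}), `MissingUpperBoundAt W p` from the Gross–Zagier /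
Kolyvagin / GZK / modularity / Cassels / Heegner-point facts, the control conclusion, the scoped FIELD-LOCAL (G-ord)
co-socket `hCoG`, the class-wide (M) co-socket `hCoM` and the off-sliver twist-unit datum. VERBATIM gen 10's
`missingUpperBoundAt_sstTwist_of_coIMCsField_of_control_of_twistUnitFieldOffSliver` with `hCoG` scoped and the extra
cell hypothesis `SubGordTwo W p → ¬ p² ∣ φ(N_W)`. CONDITIONAL; closes nothing; BSD not advanced.
[cite: JetchevSkinnerWan2017, §7.4.1] [cite: Miller2011LMS, Def. 1.1]
[cite: KellerYin2024b, Thm. 3.5.1 and Assumption 2.0.3 (preprint)] [cite: CastellaHsieh2018, Hypothesis (H)(a)]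
[cite: KrizLi2019, Thm. 1.20] -/
theorem missingUpperBoundAt_sstTwist_scope_of_coIMCsField_of_control_of_twistUnitFieldOffSliver
    (hGZ : ∀ (N : ℕ) [NeZero N] (W : WeierstrassCurve ℚ) (K : Type) [Field K] [NumberField K],
      gross_zagier N W K)
    (hKo : ∀ (N : ℕ) [NeZero N] (W : WeierstrassCurve ℚ) (K : Type) [Field K] [NumberField K],
      kolyvagin N W K)
    (hGZK : rank_eq_analyticRank_of_analyticRank_le_one) (hmod : hasEntireLFunction_rat)
    (hPar : nonempty_modularParametrizationData) (hGZ73 : GrossZagier1986_thm_I_7_3)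
    (hCassels : bsdRHS_eq_of_isIsogenous)
    (hHP : ∀ (W : WeierstrassCurve ℚ) (K : Type) [Field K] [NumberField K], exists_isHeegnerPoint W K)
    (hCtl : ∀ (W : WeierstrassCurve ℚ) [W.IsElliptic] [W.IsGloballyMinimal] (p : ℕ) [Fact p.Prime],
      W.analyticRank = 1 → p ≠ 2 → ClassX3 W p → Additive.SubSemistableTwist W p →
      AdditiveControlInputManinAt W p)
    (hCoG : ∀ (W : WeierstrassCurve ℚ) [W.IsElliptic] [W.IsGloballyMinimal] (p : ℕ) [Fact p.Prime],
      p ≠ 2 → ClassX3 W p → Additive.SubGordTwo W p → ¬ p ^ 2 ∣ Nat.totient (W.conductorNorm ℤ) →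
      (∃ Φ : AddSubgroup (geomTorsion W (p : ℤ)), IsRationalLine W p Φ ∧ ¬ LineDecompositionTrivialAt W p Φ) →
      ∀ (K : Type) [Field K] [NumberField K], IsImaginaryQuadratic K → NumberField.discr K ≠ -3 →
        AdditiveIMCUpperBDPInputManinAtField W p K)
    (hCoM : ∀ (W : WeierstrassCurve ℚ) [W.IsElliptic] [W.IsGloballyMinimal] (p : ℕ) [Fact p.Prime],
      p ≠ 2 → ClassX3 W p → Additive.SubM W p →
      (∃ Φ : AddSubgroup (geomTorsion W (p : ℤ)), IsRationalLine W p Φ ∧ ¬ LineDecompositionTrivialAt W p Φ) →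
      AdditiveIMCUpperBDPInputManinAt W p)
    (hTU : ∀ (W : WeierstrassCurve ℚ) [W.IsElliptic] [W.IsGloballyMinimal] (p : ℕ) [Fact p.Prime],
      W.analyticRank = 1 → p ≠ 2 → ClassX3 W p → Additive.SubSemistableTwist W p → TwistUnitFieldOffSliverAt W p) :
    ∀ (W : WeierstrassCurve ℚ) [W.IsElliptic] [W.IsGloballyMinimal] (p : ℕ) [Fact p.Prime],
      W.analyticRank = 1 → p ≠ 2 → ClassX3 W p → Additive.SubSemistableTwist W p →
      (Additive.SubGordTwo W p → ¬ p ^ 2 ∣ Nat.totient (W.conductorNorm ℤ)) → MissingUpperBoundAt W p := by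
  intro W _ _ p _ hr hp2 hX hS hscope
  have hpN : p ∣ W.conductorNorm ℤ := (W.dvd_conductorNorm_iff_not_hasGoodReductionAtPrime p).mpr hX.2.1
  refine missingUpperBoundAt_of_goodMemberCoStepLField_of_twistUnitFieldOffSliver hGZ hKo hGZK hmod hGZ73 hCassels
    hHP W p hr hp2 hpN (fun K _ _ hK _ hpd hdK ↦ ?_) (hTU W p hr hp2 hX hS)
  rcases hS with hM | hGo
  · exact coChainMemberField_potMult_of_coIMC_of_control hKo hPar hCtl hCoM W p hr hp2 hX hM K hK hpd
  · exact coChainMemberField_gordTwo_scope_of_coIMCField_of_control hKo hPar hCtl hCoG W p hr hp2 hX hGo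
      (hscope hGo) K hK hpd hdK

/-- **The wing on the (G-ord, `e = 2`) cell ∩ scope alone** (no (M) input): `MissingUpperBoundAt W p` for every door curve
with `SubGordTwo W p` and `¬ p² ∣ φ(N_W)`, from the facts, the control conclusion, the scoped field-local (G-ord)
co-socket and the off-sliver datum. [cite: JetchevSkinnerWan2017, §7.4.1] [cite: Miller2011LMS, Def. 1.1]
[cite: CastellaHsieh2018, Hypothesis (H)(a)] -/
theorem missingUpperBoundAt_gordTwo_scope_of_coIMCField_of_control_of_twistUnitFieldOffSliver
    (hGZ : ∀ (N : ℕ) [NeZero N] (W : WeierstrassCurve ℚ) (K : Type) [Field K] [NumberField K],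
      gross_zagier N W K)
    (hKo : ∀ (N : ℕ) [NeZero N] (W : WeierstrassCurve ℚ) (K : Type) [Field K] [NumberField K],
      kolyvagin N W K)
    (hGZK : rank_eq_analyticRank_of_analyticRank_le_one) (hmod : hasEntireLFunction_rat)
    (hPar : nonempty_modularParametrizationData) (hGZ73 : GrossZagier1986_thm_I_7_3)
    (hCassels : bsdRHS_eq_of_isIsogenous)
    (hHP : ∀ (W : WeierstrassCurve ℚ) (K : Type) [Field K] [NumberField K], exists_isHeegnerPoint W K)
    (hCtl : ∀ (W : WeierstrassCurve ℚ) [W.IsElliptic] [W.IsGloballyMinimal] (p : ℕ) [Fact p.Prime],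
      W.analyticRank = 1 → p ≠ 2 → ClassX3 W p → Additive.SubSemistableTwist W p →
      AdditiveControlInputManinAt W p)
    (hCoG : ∀ (W : WeierstrassCurve ℚ) [W.IsElliptic] [W.IsGloballyMinimal] (p : ℕ) [Fact p.Prime],
      p ≠ 2 → ClassX3 W p → Additive.SubGordTwo W p → ¬ p ^ 2 ∣ Nat.totient (W.conductorNorm ℤ) →
      (∃ Φ : AddSubgroup (geomTorsion W (p : ℤ)), IsRationalLine W p Φ ∧ ¬ LineDecompositionTrivialAt W p Φ) →
      ∀ (K : Type) [Field K] [NumberField K], IsImaginaryQuadratic K → NumberField.discr K ≠ -3 →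
        AdditiveIMCUpperBDPInputManinAtField W p K)
    (hTU : ∀ (W : WeierstrassCurve ℚ) [W.IsElliptic] [W.IsGloballyMinimal] (p : ℕ) [Fact p.Prime],
      W.analyticRank = 1 → p ≠ 2 → ClassX3 W p → Additive.SubSemistableTwist W p → TwistUnitFieldOffSliverAt W p) :
    ∀ (W : WeierstrassCurve ℚ) [W.IsElliptic] [W.IsGloballyMinimal] (p : ℕ) [Fact p.Prime],
      W.analyticRank = 1 → p ≠ 2 → ClassX3 W p → Additive.SubGordTwo W p →
      ¬ p ^ 2 ∣ Nat.totient (W.conductorNorm ℤ) → MissingUpperBoundAt W p := by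
  intro W _ _ p _ hr hp2 hX hGo hsc
  have hpN : p ∣ W.conductorNorm ℤ := (W.dvd_conductorNorm_iff_not_hasGoodReductionAtPrime p).mpr hX.2.1
  exact missingUpperBoundAt_of_goodMemberCoStepLField_of_twistUnitFieldOffSliver hGZ hKo hGZK hmod hGZ73 hCassels
    hHP W p hr hp2 hpN
    (fun K _ _ hK _ hpd hdK ↦ coChainMemberField_gordTwo_scope_of_coIMCField_of_control hKo hPar hCtl hCoG W p hr
      hp2 hX hGo hsc K hK hpd hdK)
    (hTU W p hr hp2 hX (Or.inr hGo))

/-! ### §3 From NAMED inputs: the wing on (M) ∪ ((G-ord) ∩ scope) with NO off-scope input; leaf candidate v4 -/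

/-- **The second wing on (M) ∪ ((G-ord, `e = 2`) ∩ {`¬ p² ∣ φ(N_W)`}) from NAMED inputs, NO off-scope input:**
`PrintedFacts → ControlFacts → (CM-rationality ∧ CST 1.1) → (Darmon 3.6 ∧ CST 1.5) → thm351_charIdeal_eq_branch_OPEN →
castellaHsieh2018_… → KYReadCHValueUnitH → KYCHMUnitOriented → hTU′ →` the upper half at every door curve in that
locus (557 of the 2 560 (G-ord) census pairs + all 4 541 (M) pairs). The (G-ord) co-socket is §1's scoped record, the
(M) co-socket gen 10's `coIMC_potMult_of_PotMultRead`, the control the CLOSED item 19548. CONDITIONAL on every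
displayed hypothesis; closes no item; BSD NOT advanced. [cite: Miller2011LMS, Def. 1.1]
[cite: JetchevSkinnerWan2017, §7.4.1 (arXiv:1512.06894 p. 30)] [cite: KellerYin2024b, Thm. 3.5.1 (preprint)]
[cite: CastellaHsieh2018, Hypothesis (H)(a), Prop. 3.8, Thm. 5.7 and Lemma 5.4] [cite: KrizLi2019, Thm. 1.20 (shape of hTU′)] -/
theorem missingUpperBoundAt_sstTwist_scope_of_KYReadBranchH_of_PotMultRead_of_twistUnitFieldOffSliver
    (hF : PrintedFacts) (hCF : ControlFacts)
    (hRG : phi_heegnerPointOfConductor_mem_ringClassField ∧ thm11_ringClassChar)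
    (hRM : Literature.NumberTheory.EllipticCurves.phi_heegnerPointOfConductor_mem_range_map_ringClassField_of_prime_dvd_level ∧
      Literature.NumberTheory.EllipticCurves.thm15_ringClassChar_primeConductor_dvd_level)
    (hKYb : thm351_charIdeal_eq_branch_OPEN) (hCHx : castellaHsieh2018_exists_isBranchBDPLFunction)
    (hValUH : KYReadCHValueUnitH) (hKYu : KYCHMUnitOriented)
    (hTU : ∀ (W : WeierstrassCurve ℚ) [W.IsElliptic] [W.IsGloballyMinimal] (p : ℕ) [Fact p.Prime],
      W.analyticRank = 1 → p ≠ 2 → ClassX3 W p → Additive.SubSemistableTwist W p → TwistUnitFieldOffSliverAt W p) :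
    ∀ (W : WeierstrassCurve ℚ) [W.IsElliptic] [W.IsGloballyMinimal] (p : ℕ) [Fact p.Prime],
      W.analyticRank = 1 → p ≠ 2 → ClassX3 W p → Additive.SubSemistableTwist W p →
      (Additive.SubGordTwo W p → ¬ p ^ 2 ∣ Nat.totient (W.conductorNorm ℤ)) → MissingUpperBoundAt W p := by
  have hCoM := coIMC_potMult_of_PotMultRead hF hCF hRM hKYu
  obtain ⟨hGZ, hKo, hGZK, hmod, hPar, hCas, hGZ73, -, -, hHP, -, -, -⟩ := hF
  have hCoG := additiveIMCUpperBDPInputManinAtField_of_facts_of_KY_branch_of_CHValueUnitH hCF.1 hKo hGZ hmod hPar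
    hRG.1 hRG.2 hKYb hCHx hValUH
  have hCtl := SchneiderFreeAdditiveX3.anticycControlAdditiveKF_proof hCF.1 hCF.2.1 hCF.2.2.1 hCF.2.2.2 hKo
  exact missingUpperBoundAt_sstTwist_scope_of_coIMCsField_of_control_of_twistUnitFieldOffSliver hGZ hKo hGZK hmod hPar
    hGZ73 hCas hHP hCtl hCoG hCoM hTU

/-- **The sibling route's RUNG-LEAF candidate `Upper.AdditiveX3RankOneUpper` from NAMED inputs, v4 — the value input
SPLIT at Castella–Hsieh's print scope:** `PrintedFacts → ControlFacts → (CM-rationality ∧ CST 1.1) → (Darmon 3.6 ∧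
CST 1.5) → thm351_charIdeal_eq_branch_OPEN → castellaHsieh2018_… → KYReadCHValueUnitH (in print, (H)(a)-scope) →
KYReadCHValueUnitOffScope (NOT in print) → KYCHMUnitOriented → hTU′ → AdditiveX3RankOneUpper`. = v3
(`additiveX3RankOneUpper_of_KYReadBranch_of_PotMultRead_of_twistUnitFieldOffSliver`, p502451) composed with
`kyReadCHValueUnit_of_unitH_of_offScope`; if the off-scope input is ever shown typable the two collapse.
CONDITIONAL on every displayed hypothesis; the leaf is declared, NOT registered; closes no item; BSD NOT advanced.
[cite: Miller2011LMS, Def. 1.1] [cite: JetchevSkinnerWan2017, §7.4.1 (arXiv:1512.06894 p. 30)]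
[cite: KellerYin2024b, Thm. 3.5.1 and §3.4–3.5 (arXiv:2410.23241) (preprint; hypotheses)]
[cite: CastellaHsieh2018, Hypothesis (H)(a), Prop. 3.8, Thm. 5.7 and Lemma 5.4] [cite: KrizLi2019, Thm. 1.20 (shape of hTU′)] -/
theorem additiveX3RankOneUpper_of_KYReadBranchH_of_offScope_of_PotMultRead_of_twistUnitFieldOffSliver
    (hF : PrintedFacts) (hCF : ControlFacts)
    (hRG : phi_heegnerPointOfConductor_mem_ringClassField ∧ thm11_ringClassChar)
    (hRM : Literature.NumberTheory.EllipticCurves.phi_heegnerPointOfConductor_mem_range_map_ringClassField_of_prime_dvd_level ∧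
      Literature.NumberTheory.EllipticCurves.thm15_ringClassChar_primeConductor_dvd_level)
    (hKYb : thm351_charIdeal_eq_branch_OPEN) (hCHx : castellaHsieh2018_exists_isBranchBDPLFunction)
    (hValUH : KYReadCHValueUnitH) (hValUOff : KYReadCHValueUnitOffScope) (hKYu : KYCHMUnitOriented)
    (hTU : ∀ (W : WeierstrassCurve ℚ) [W.IsElliptic] [W.IsGloballyMinimal] (p : ℕ) [Fact p.Prime],
      W.analyticRank = 1 → p ≠ 2 → ClassX3 W p → Additive.SubSemistableTwist W p → TwistUnitFieldOffSliverAt W p) :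
    AdditiveX3RankOneUpper :=
  additiveX3RankOneUpper_of_KYReadBranch_of_PotMultRead_of_twistUnitFieldOffSliver hF hCF hRG hRM hKYb hCHx
    (kyReadCHValueUnit_of_unitH_of_offScope hValUH hValUOff) hKYu hTU

end Summit.BirchSwinnertonDyer.BirchSwinnertonDyer.Theorems.SchneiderFree.Upper

end
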